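import Literature.Topology.FourManifolds.CappellShanesonGompfChains
import Literature.Topology.FourManifolds.CappellShanesonClassGroupTwelve
import HarnessLib

/-!
# An unconditional Gompf chain for the exceptional class of trace `57`

Serves the named fact
`Literature.Topology.FourManifolds.kimYamada2023_nonempty_diffeomorph_sphere_four_of_trace_mem_Icc`
(`CappellShaneson.lean`; M. H. Kim, S. Yamada, Kyungpook Math. J. 63 (2023) 373–411 =
arXiv:1707.03860, Cor. C) through Theorem B for the trace `57`. In KY §6.1 the minimal
representative `(15, 109, 57)` of the one class of `C(ℤ[Θ₅₇])` not covered by Lemma 6.1 is moved by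
`(15,109,57) ∼_G (15,109,-52) ∼_S (18,79,-52) ∼_G (18,79,27)`, i.e. it lands on the trace `27`, the
one trace whose order `ℤ[Θ₂₇]` is not Dedekind (KY §4.3). Here the chain is continued inside the
trace `27` by one more similarity, found by a lattice search for a unimodular intertwiner and
certified by the kernel: `X_{18,79,27} ∼_S X_{14,19,27}` with
`P = !![124, -215, 165; 15, -26, 20; -10, 19, -6]`, and then `(14,19,27) ∼_G (14,19,8)` lands on the
trace `8`, where Gompf's conjecture is proved (`gompfConjectureForTrace_of_mem_Icc_neg_seven_twelve`).
So `X_{15,109,57} ∼ A₀` unconditionally; likewise for the inverse class, `(15,79,57) ∼_G (15,79,-22) ∼_S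
(4,19,-22) ∼_G (4,19,-3)` avoids the trace `-22 = 5 - 27`. Theorems only; no named fact (D-0026).

## References

* [KimYamada2023] M. H. Kim, S. Yamada, Kyungpook Math. J. 63 (2023) 373–411 (arXiv:1707.03860):
  §6.1 (proof of Thm. B, the chain for `(15,109,57)`), Remark 2.21 (`∼_S` = similarity), Def. 2.18.
-/

noncomputable section

open Set Polynomial
open scoped MatrixGroups

namespace Literature.Topology.FourManifolds

/-- **`(18,79,27) ∼_S (14,19,27)`**, certified by the unimodular `P = !![124, -215, 165; 15, -26, 20;
-10, 19, -6]` (`det P = -1`) with `P X_{18,79,27} = X_{14,19,27} P` (found by reducing the lattice of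
integer intertwiners and searching its determinant form for `±1`). [cite: KimYamada2023, Remark 2.21 (similarity of standard matrices)] -/
theorem isConj_standardCSMatrix_18_79_14_19 (h : (79 : ℤ) ∣ (csPoly 27).eval 18)
    (h' : (19 : ℤ) ∣ (csPoly 27).eval 14) :
    IsConj (standardCSMatrix 18 79 27 h) (standardCSMatrix 14 19 27 h') :=
  isConj_standardCSMatrix_of_mul_eq h h' !![124, -215, 165; 15, -26, 20; -10, 19, -6]
    (by decide) (by simp only [standardCSMatrixVal, csEntryA, eval_csPoly]; decide)

/-- **The exceptional representative `(15,109,57)` lands on the trace `8`**: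
`(15,109,57) ∼_G (15,109,-52) ∼_S (18,79,-52) ∼_G (18,79,27) ∼_S (14,19,27) ∼_G (14,19,8)`.
[cite: KimYamada2023, §6.1 (proof of Thm. B, trace 57)] -/
theorem gompfEquiv_standardCSMatrix_15_109_57_eight (h : (109 : ℤ) ∣ (csPoly 57).eval 15) :
    ∃ h' : (19 : ℤ) ∣ (csPoly 8).eval 14,
      GompfEquiv (standardCSMatrix 15 109 57 h) (standardCSMatrix 14 19 8 h') := by
  obtain ⟨h1, e1⟩ := gompfEquiv_standardCSMatrix_15_109_57 h
  have h2 : (19 : ℤ) ∣ (csPoly 27).eval 14 := by norm_num [eval_csPoly]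
  have e2 := GompfEquiv.of_isConj (isConj_standardCSMatrix_18_79_14_19 h1 h2)
  obtain ⟨h3, e3⟩ :=
    gompfEquiv_standardCSMatrix_of_add_mul_eq (n' := 8) h2 (-1) (by norm_num)
  exact ⟨h3, ((e1).trans e2).trans e3⟩

/-- Hence **`X_{15,109,57} ∼ A₀` unconditionally** (Gompf's conjecture for the trace `8` is proved).
[cite: KimYamada2023, §6.1 (proof of Thm. B, trace 57)] -/
theorem gompfEquiv_akbulutKirbyMatrix_15_109_57_eight (h : (109 : ℤ) ∣ (csPoly 57).eval 15) :
    GompfEquiv (standardCSMatrix 15 109 57 h) akbulutKirbyMatrix := by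
  obtain ⟨h', e⟩ := gompfEquiv_standardCSMatrix_15_109_57_eight h
  exact e.trans
    ((gompfConjectureForTrace_of_mem_Icc_neg_seven_twelve (n := 8) (by norm_num)).standardCSMatrix h')

/-! ### The inverse class: `(15, 79, 57)` lands on the trace `-3` -/

/-- **`(15,79,-22) ∼_S (4,19,-22)`**, certified by the unimodular `P = !![-26, -186, -21; 6, 43, 5;
-1, -7, 0]` (`det P = -1`) with `P X_{15,79,-22} = X_{4,19,-22} P` (lattice search as above). [cite: KimYamada2023, Remark 2.21 (similarity of standard matrices)] -/
theorem isConj_standardCSMatrix_15_79_4_19 (h : (79 : ℤ) ∣ (csPoly (-22)).eval 15)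
    (h' : (19 : ℤ) ∣ (csPoly (-22)).eval 4) :
    IsConj (standardCSMatrix 15 79 (-22) h) (standardCSMatrix 4 19 (-22) h') :=
  isConj_standardCSMatrix_of_mul_eq h h' !![-26, -186, -21; 6, 43, 5; -1, -7, 0]
    (by decide) (by simp only [standardCSMatrixVal, csEntryA, eval_csPoly]; decide)

/-- **The representative `(15,79,57)` of the inverse exceptional class lands on the trace `-3`**:
`(15,79,57) ∼_G (15,79,-22) ∼_S (4,19,-22) ∼_G (4,19,-3)` (KY's Lemma 6.1 would send `(15,79,57)`
to the trace `-22 = 5 - 27`, the partner of the non-Dedekind trace `27`; the extra similarity inside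
the trace `-22` avoids it). [cite: KimYamada2023, §6.1 (proof of Thm. B, trace 57) and Lemma 6.1] -/
theorem gompfEquiv_standardCSMatrix_15_79_57_negThree (h : (79 : ℤ) ∣ (csPoly 57).eval 15) :
    ∃ h' : (19 : ℤ) ∣ (csPoly (-3)).eval 4,
      GompfEquiv (standardCSMatrix 15 79 57 h) (standardCSMatrix 4 19 (-3) h') := by
  obtain ⟨h1, e1⟩ :=
    gompfEquiv_standardCSMatrix_of_add_mul_eq (n' := (-22)) h (-1) (by norm_num)
  have h2 : (19 : ℤ) ∣ (csPoly (-22)).eval 4 := by norm_num [eval_csPoly]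
  have e2 := GompfEquiv.of_isConj (isConj_standardCSMatrix_15_79_4_19 h1 h2)
  obtain ⟨h3, e3⟩ :=
    gompfEquiv_standardCSMatrix_of_add_mul_eq (n' := (-3)) h2 (1) (by norm_num)
  exact ⟨h3, ((e1).trans e2).trans e3⟩

/-- Hence **`X_{15,79,57} ∼ A₀` unconditionally** (Gompf's conjecture for the trace `-3` is proved).
[cite: KimYamada2023, §6.1 (proof of Thm. B, trace 57)] -/
theorem gompfEquiv_akbulutKirbyMatrix_15_79_57_negThree (h : (79 : ℤ) ∣ (csPoly 57).eval 15) :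
    GompfEquiv (standardCSMatrix 15 79 57 h) akbulutKirbyMatrix := by
  obtain ⟨h', e⟩ := gompfEquiv_standardCSMatrix_15_79_57_negThree h
  exact e.trans
    ((gompfConjectureForTrace_of_mem_Icc_neg_seven_twelve (n := -3) (by norm_num)).standardCSMatrix h')

end Literature.Topology.FourManifolds

end
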